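import Mathlib

/-!
# The three-colour lemma for gauge gadgets
(dichotomy `WindowBarrier` stmt-PneNP-2145 / `NoHiddenOrder` stmt-PneNP-14781, route `PneNP/SymmetryBudget`;
memo `SYMCAN-ANALYSIS.md` §4.3, evidence on both items)

Every witness proposal for HardToIdentify / the entropy game so far is a GAUGE CONSTRUCTION: sites with local gauge
groups, gadgets gluing them, and two graphs that differ by a global twist; Duplicator survives by re-identifying
gadgets with elements of the gauge group `F` acting on the gadget's vertex set `Ω`, and the STATES of a gadget are the
translates `f • Σ` of its edge set `Σ ⊆ Ω × Ω`, so the state-preserving subgroup is the set-stabiliser of `Σ` and the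
twist-moving re-identifications are the elements outside it.  Spoiler's weapon (colouring robustness,
`CosetGame.colourRobust_of_hardToIdentify`) is a vertex colouring that every re-identification must preserve.

* `GaugeGadget.exists_mem_stabilizer_sup_ne_top` — if a subset `S` of an `F`-set is invariant under a normal subgroup
  `N` but not under `F`, some point `x ∈ S` has `N ⊔ Stab_F(x) ≠ ⊤` (otherwise `f = n s` with `s x = x`, `n ∈ N` keeps
  `f • x ∈ S`);
* `GaugeGadget.exists_mem_stabilizer_le` — if moreover `N` has prime index, that point has `Stab_F(x) ≤ N`;
* **`GaugeGadget.threeColourLemma`** — for a gadget (`F` acting on `Ω`, edge set `Σ ⊆ Ω × Ω` invariant under a normal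
  subgroup `N` of prime index but not under `F`): there are two vertices `w, w'` such that every `f ∈ F` preserving the
  colouring "`w ↦ 1`, `w' ↦ 2`, everything else `↦ 0`" lies in `N`.  So two specially coloured vertices per gadget
  freeze every state change through a prime-index (e.g. parity, or sign-of-permutation) quotient: CFI / Tseitin / 𝔽_p
  systems and all "sign coupling of symmetric twin clouds" die at `K = 2` colour bits, whatever the base graph and the
  gauge groups (memo §4.3; iterate along a subnormal series with prime steps for soluble state groups).

* `GaugeGadget.oneBitLemma` — an ABELIAN gauge acting faithfully on a site loses everything to one colour bit (one
  coloured vertex per orbit): memo §4.2.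

Pure group theory over Mathlib (`MulAction`, `Subgroup.Normal`, `Subgroup.index`); no circuits, no sorry.
-/

set_option linter.dupNamespace false -- `Summit.PneNP.PneNP.…`: summit = sub-problem name (D-0017 single-conjunct layout)

namespace Summit.PneNP.PneNP.Theorems

namespace GaugeGadget

open MulAction Pointwise

variable {F : Type*} [Group F] {Ω : Type*} [MulAction F Ω]

/-- **Invariance defect localises at a point.**  If `S` is invariant under the normal subgroup `N` but not under
the whole group, some `x ∈ S` has `N ⊔ Stab(x) ≠ ⊤`. -/
theorem exists_mem_stabilizer_sup_ne_top (N : Subgroup F) [N.Normal] (S : Set Ω)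
    (hN : ∀ n ∈ N, n • S = S) (hF : ∃ f : F, f • S ≠ S) :
    ∃ x ∈ S, N ⊔ stabilizer F x ≠ ⊤ := by
  by_contra h
  push Not at h
  have key : ∀ f : F, f • S ⊆ S := by
    intro f y hy
    obtain ⟨x, hx, rfl⟩ := Set.mem_smul_set.1 hy
    have hf : f ∈ ((N ⊔ stabilizer F x : Subgroup F) : Set F) := by
      rw [h x hx]
      exact Subgroup.mem_top f
    rw [Subgroup.normal_mul] at hf
    obtain ⟨n, hn, s, hs, rfl⟩ := Set.mem_mul.1 hf
    rw [mul_smul, mem_stabilizer_iff.1 hs, ← hN n hn]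
    exact Set.smul_mem_smul_set hx
  obtain ⟨f, hf⟩ := hF
  refine hf (Set.Subset.antisymm (key f) ?_)
  intro y hy
  have h1 : f⁻¹ • y ∈ S := key f⁻¹ (Set.smul_mem_smul_set hy)
  have h2 : f • (f⁻¹ • y) ∈ f • S := Set.smul_mem_smul_set h1
  rwa [smul_inv_smul] at h2

/-- **Prime index: the stabiliser of the defect point lies inside `N`.** -/
theorem exists_mem_stabilizer_le (N : Subgroup F) [N.Normal] (hp : N.index.Prime) (S : Set Ω)
    (hN : ∀ n ∈ N, n • S = S) (hF : ∃ f : F, f • S ≠ S) :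
    ∃ x ∈ S, stabilizer F x ≤ N := by
  obtain ⟨x, hx, hne⟩ := exists_mem_stabilizer_sup_ne_top N S hN hF
  refine ⟨x, hx, ?_⟩
  -- `N ≤ N ⊔ Stab(x) < ⊤` and `N` has prime index, so `N ⊔ Stab(x) = N`
  have hle : N ≤ N ⊔ stabilizer F x := le_sup_left
  have hdvd : (N ⊔ stabilizer F x).index ∣ N.index := Subgroup.index_dvd_of_le hle
  have hne1 : (N ⊔ stabilizer F x).index ≠ 1 := fun h1 => hne (Subgroup.index_eq_one.1 h1)
  have heq : (N ⊔ stabilizer F x).index = N.index :=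
    ((Nat.dvd_prime hp).1 hdvd).resolve_left hne1
  have hrel : N.relIndex (N ⊔ stabilizer F x) * (N ⊔ stabilizer F x).index = N.index :=
    Subgroup.relIndex_mul_index hle
  rw [heq] at hrel
  have hidx : N.index ≠ 0 := hp.ne_zero
  have hrel1 : N.relIndex (N ⊔ stabilizer F x) = 1 := by
    have : N.relIndex (N ⊔ stabilizer F x) * N.index = 1 * N.index := by rw [hrel, one_mul]
    exact Nat.eq_of_mul_eq_mul_right (Nat.pos_of_ne_zero hidx) this
  have hge : N ⊔ stabilizer F x ≤ N := Subgroup.relIndex_eq_one.1 hrel1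
  exact le_sup_right.trans hge

/-- **The three-colour lemma.**  Let `F` act on the vertex set `Ω` of a gadget with edge set `Σ ⊆ Ω × Ω` (acted on
diagonally), invariant under a normal subgroup `N` of prime index — the state-preserving re-identifications — but not
under `F`.  Then there are vertices `w, w'` such that every element of `F` preserving the colouring
`w ↦ 1, w' ↦ 2, rest ↦ 0` lies in `N`: two special colours freeze every state change of the gadget. -/
theorem threeColourLemma : ∀ {F : Type} [Group F] {Ω : Type} [MulAction F Ω] [DecidableEq Ω] (N : Subgroup F) [N.Normal], N.index.Prime → ∀ E : Set (Ω × Ω), (∀ n ∈ N, n • E = E) → (∃ f : F, f • E ≠ E) → ∃ w w' : Ω, ∀ f : F, (∀ a : Ω, (if f • a = w then 1 else if f • a = w' then 2 else (0 : ℕ)) = (if a = w then 1 else if a = w' then 2 else 0)) → f ∈ N := by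
  intro F _ Ω _ _ N _ hp E hN hF
  obtain ⟨⟨w, w'⟩, -, hstab⟩ := exists_mem_stabilizer_le N hp E hN hF
  refine ⟨w, w', fun f hf => hstab (mem_stabilizer_iff.2 ?_)⟩
  have hw : f • w = w := by
    have h := hf w
    rw [if_pos (rfl : w = w)] at h
    by_contra hne
    rw [if_neg hne] at h
    by_cases h2 : f • w = w'
    · rw [if_pos h2] at h; simp at h
    · rw [if_neg h2] at h; simp at h
  have hw' : f • w' = w' := by
    by_cases hww : w' = w
    · rw [hww]; exact hw
    have h := hf w'
    rw [if_neg hww, if_pos (rfl : w' = w')] at h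
    by_contra hne
    rw [if_neg hne] at h
    by_cases h1 : f • w' = w
    · rw [if_pos h1] at h; simp at h
    · rw [if_neg h1] at h; simp at h
  rw [Prod.smul_mk, hw, hw']

/-- **The one-bit lemma (abelian torsors).**  If an ABELIAN gauge group `A` acts faithfully on the vertices of a
site and Spoiler colours exactly one vertex in every orbit (the set `P`; one colour bit, all chosen vertices alike),
then only the identity of `A` preserves the colouring: an element preserving `P` fixes each chosen vertex (it cannot
leave the orbit), hence — `A` being abelian — every vertex of that orbit, hence everything.  So CFI / Tseitin /
𝔽_p-system / abelian-cover constructions lose all gauge freedom to ONE colour bit, whatever the base graph or the group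
(memo §4.2; the general form of "one bipartition kills Cai–Fürer–Immerman"). -/
theorem oneBitLemma : ∀ {A : Type} [CommGroup A] {X : Type} [MulAction A X] [FaithfulSMul A X] (P : Set X), (∀ x : X, ∃ p ∈ P, p ∈ MulAction.orbit A x ∧ ∀ q ∈ P, q ∈ MulAction.orbit A x → q = p) → ∀ a : A, (fun x : X => a • x) '' P = P → a = 1 := by
  intro A _ X _ _ P hP a ha
  have hfix : ∀ p ∈ P, a • p = p := by
    intro p hp
    obtain ⟨p₀, -, -, huniq⟩ := hP p
    have h1 : a • p ∈ P := by rw [← ha]; exact Set.mem_image_of_mem _ hp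
    rw [huniq _ h1 (mem_orbit p a), huniq _ hp (mem_orbit_self p)]
  have hall : ∀ x : X, a • x = (1 : A) • x := by
    intro x
    obtain ⟨p, hpP, hporb, -⟩ := hP x
    obtain ⟨b, rfl⟩ := mem_orbit_iff.1 hporb
    have h := hfix (b • x) hpP
    rw [one_smul]
    calc a • x = b⁻¹ • (b • (a • x)) := by rw [inv_smul_smul]
      _ = b⁻¹ • (a • (b • x)) := by rw [smul_smul b a, smul_smul a b, mul_comm]
      _ = x := by rw [h, inv_smul_smul]
  exact FaithfulSMul.eq_of_smul_eq_smul hall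

end GaugeGadget

end Summit.PneNP.PneNP.Theorems
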